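import Mathlib
import Literature.RingTheory.CohomologyAnnihilator.BirationalTransfer
import HarnessLib

/-!
# Two-step transfer of stable annihilation (card A4·S1 `TwoStepTransfer`)

Crux `HomologicalConductor.Persistence` (stmt-ResolutionOfSingularities-16484), chain W4.4b, card A4
`covariant-two-step-presentation` of res-L1-w44b-idea-1 (g2), first lemma `TwoStepTransfer`
(CRUX-PLAN v3 §3.1 T-HOLD "land-now piece"; ASSIGN v0.7 gave it to idea-1 g2, whose session ended
without a Theorems landing — taken by stub-3 successor; tri-2 TRIAGE v3: "typed and TRUE, landable
today"). `[OURS · L1 w44b]` — elementary diagram chase about stable annihilation (factorisations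
`β ∘ α = y • id` through a finite free module `Fin s → C`, the card's `FactorsThroughFree` kept
UNFOLDED); NOT a statement of the manuscript under review; AI-drafted (weaker than expert review).

**`exists_comp_eq_smul_id_of_twoStep`.** Let `P₁ —ι→ P₀ —π→ X → 0` be exact at `P₀` with `π`
onto (`ι` need not be injective). If `y • 1_{P₀}` factors through `Cˢ` (`β α = y • id`),
`y' • 1_{P₁}` factors through `Cˢ'` (`β' α' = y' • id`), and every linear map `P₁ → Cᵗ` extends along
`ι` (the secondary obstruction vanishes), then `(y y') • 1_X` factors through `Cˢ`: with `ψ ι = α'`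
the endomorphism `θ = y' • 1 - ι β' ψ` of `P₀` kills `ι(P₁) = ker π`, so descends to `θ̄ : X → P₀`
with `θ̄ π = θ`, `π θ̄ = y' • 1_X`; then `(y y') • 1_X = (π β) ∘ (α θ̄)`.
`smul_ext_eq_zero_of_twoStep` is the `Ext` consequence (tree
`smul_ext_eq_zero_of_linearMap_comp_eq_smul_id`): `y y'` kills `Ext^{≥1}_C(X, -)` — exponent
`1 + 1`, the card's "exponent TWO at level 4".
-/

-- single-problem summit: the doubled namespace component is forced
set_option linter.dupNamespace false

noncomputable section

open CategoryTheory CategoryTheory.Abelian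

universe u v

namespace Summit.ResolutionOfSingularities.ResolutionOfSingularities.Theorems.HomologicalConductor.PersistenceTwoStepTransfer

open Literature.RingTheory.CohomologyAnnihilator

variable {C : Type u} [CommRing C]

/-- **Two-step transfer** (card A4·S1 `TwoStepTransfer`): along `P₁ —ι→ P₀ —π→ X → 0` (exact at
`P₀`, `π` onto), stable factorisations `β α = y • 1_{P₀}` through `Cˢ` and `β' α' = y' • 1_{P₁}`
through `Cˢ'` give a stable factorisation of `(y y') • 1_X` through `Cˢ`, provided every linear map
`P₁ → Cᵗ` extends along `ι`. [folklore] -/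
theorem exists_comp_eq_smul_id_of_twoStep {X P₀ P₁ : Type*} [AddCommGroup X] [Module C X]
    [AddCommGroup P₀] [Module C P₀] [AddCommGroup P₁] [Module C P₁] (ι : P₁ →ₗ[C] P₀)
    (π : P₀ →ₗ[C] X) (hexact : Function.Exact ι π) (hπ : Function.Surjective π) {y y' : C}
    {s : ℕ} (α : P₀ →ₗ[C] (Fin s → C)) (β : (Fin s → C) →ₗ[C] P₀)
    (hαβ : β ∘ₗ α = y • LinearMap.id) {s' : ℕ} (α' : P₁ →ₗ[C] (Fin s' → C))
    (β' : (Fin s' → C) →ₗ[C] P₁) (hαβ' : β' ∘ₗ α' = y' • LinearMap.id)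
    (hext : ∀ (t : ℕ) (φ : P₁ →ₗ[C] (Fin t → C)), ∃ ψ : P₀ →ₗ[C] (Fin t → C), ψ ∘ₗ ι = φ) :
    ∃ (ιX : X →ₗ[C] (Fin s → C)) (πX : (Fin s → C) →ₗ[C] X),
      πX ∘ₗ ιX = (y * y') • LinearMap.id := by
  obtain ⟨ψ, hψ⟩ := hext s' α'
  -- `θ = y' • 1 - ι β' ψ` kills `ker π = range ι`
  let θ : P₀ →ₗ[C] P₀ := y' • LinearMap.id - ι ∘ₗ β' ∘ₗ ψ
  have hθι : ∀ q : P₁, θ (ι q) = 0 := fun q => by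
    have h1 : ψ (ι q) = α' q := LinearMap.congr_fun hψ q
    have h2 : β' (α' q) = y' • q := LinearMap.congr_fun hαβ' q
    change y' • ι q - ι (β' (ψ (ι q))) = 0
    rw [h1, h2, map_smul, sub_self]
  have hker : LinearMap.ker π ≤ LinearMap.ker θ := by
    intro p hp
    obtain ⟨q, rfl⟩ := (hexact p).mp hp
    exact hθι q
  -- descend `θ` to `θ̄ : X → P₀`
  let θbar : X →ₗ[C] P₀ :=
    (LinearMap.ker π).liftQ θ hker ∘ₗ (π.quotKerEquivOfSurjective hπ).symm.toLinearMap
  have hθbar : ∀ p : P₀, θbar (π p) = θ p := fun p => by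
    have hs : (π.quotKerEquivOfSurjective hπ).symm (π p) = Submodule.Quotient.mk p := by
      rw [LinearEquiv.symm_apply_eq, LinearMap.quotKerEquivOfSurjective_apply_mk]
    change (LinearMap.ker π).liftQ θ hker ((π.quotKerEquivOfSurjective hπ).symm (π p)) = θ p
    rw [hs, Submodule.liftQ_apply]
  have hπι : ∀ q : P₁, π (ι q) = 0 := fun q => (hexact (ι q)).mpr ⟨q, rfl⟩
  refine ⟨α ∘ₗ θbar, π ∘ₗ β, LinearMap.ext fun x => ?_⟩
  obtain ⟨p, rfl⟩ := hπ x
  have h3 : β (α (θ p)) = y • θ p := LinearMap.congr_fun hαβ (θ p)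
  simp only [LinearMap.comp_apply, hθbar, h3, map_smul, LinearMap.smul_apply, LinearMap.id_apply]
  change y • π (y' • p - ι (β' (ψ p))) = (y * y') • π p
  rw [map_sub, hπι, sub_zero, map_smul, mul_smul]

/-- **Two-step transfer, `Ext` form**: in the situation of `exists_comp_eq_smul_id_of_twoStep`,
`y y'` kills `Extⁱ_C(X, M)` for every `C`-module `M` and every `i ≥ 1`. [folklore] -/
theorem smul_ext_eq_zero_of_twoStep {X P₀ P₁ : Type u} [AddCommGroup X] [Module C X]
    [AddCommGroup P₀] [Module C P₀] [AddCommGroup P₁] [Module C P₁] (ι : P₁ →ₗ[C] P₀)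
    (π : P₀ →ₗ[C] X) (hexact : Function.Exact ι π) (hπ : Function.Surjective π) {y y' : C}
    {s : ℕ} (α : P₀ →ₗ[C] (Fin s → C)) (β : (Fin s → C) →ₗ[C] P₀)
    (hαβ : β ∘ₗ α = y • LinearMap.id) {s' : ℕ} (α' : P₁ →ₗ[C] (Fin s' → C))
    (β' : (Fin s' → C) →ₗ[C] P₁) (hαβ' : β' ∘ₗ α' = y' • LinearMap.id)
    (hext : ∀ (t : ℕ) (φ : P₁ →ₗ[C] (Fin t → C)), ∃ ψ : P₀ →ₗ[C] (Fin t → C), ψ ∘ₗ ι = φ)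
    (M : ModuleCat.{u} C) {i : ℕ} (hi : 1 ≤ i) (e : Ext.{u} (ModuleCat.of C X) M i) :
    (y * y') • e = 0 := by
  obtain ⟨ιX, πX, h⟩ := exists_comp_eq_smul_id_of_twoStep ι π hexact hπ α β hαβ α' β' hαβ' hext
  exact smul_ext_eq_zero_of_linearMap_comp_eq_smul_id ιX πX h M hi e

end Summit.ResolutionOfSingularities.ResolutionOfSingularities.Theorems.HomologicalConductor.PersistenceTwoStepTransfer

end
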